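import Summits.BirchSwinnertonDyer.BirchSwinnertonDyer.Theses.ResidualThetaTransportAtTwo
import Summits.BirchSwinnertonDyer.BirchSwinnertonDyer.Theorems.ResidualThetaTransportAtTwoResidualThetaMainConjectureAtTwoAnalyticLayerLawKAtTwo
import Summits.BirchSwinnertonDyer.BirchSwinnertonDyer.Theorems.ThetaPartnerAtTwoSignedTransportAtTwoRlfLambdaOfPrint
import Summits.BirchSwinnertonDyer.BirchSwinnertonDyer.Theorems.ByReductionTypeAtTwoSupersingularSharpTwo
import Summits.BirchSwinnertonDyer.Rank1Residual.X1.LambdaSqueezeAlgebra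
import Summits.BirchSwinnertonDyer.Rank1Residual.X2.EulerFactorInvariants
import Literature.NumberTheory.EllipticCurves.MatsunoLocalTermAtTwoReductionTypeProofs
import Literature.NumberTheory.EllipticCurves.LeadingTermPPartProofs
import Literature.NumberTheory.EllipticCurves.MordellWeilRankZeroProofs
import HarnessLib

/-!
# Crux RMC `ResidualThetaCountAtTwo` (stmt-BirchSwinnertonDyer-24195), route `ResidualThetaTransportAtTwo`:
# RMC BY NAME from the route's own items — the two-sided residual theta count carries no research content beyond the
# one-sided count RTC≥ (25435) / its pure form (R≥)ᵖ (26074)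

Cell `bsd-wall`, seat `bsd-rtt-w5` g0 (width prover on 24195; `--supports`; closes nothing). THEOREMS ONLY — no `def`, no
named fact, no `sorry`; every research input is a route decl BY NAME; nothing about any curve is asserted and BSD is
not proved by any of this.

THE POINT (kernel-exact). RMC (24195) reads: on the habitat⁺, for a CM partner `(M, g, ι)` at a COHOMOLOGICAL plus period
`Ω`, cyclotomic `(κ, γ)`, admissible odd `S₀`, a torsion `μ = 0` signed `+` dual datum `D` of `W`, an `𝓞`-Pollack pair
`(L⁺, L⁻)` of `g` with norm-λ `d` of `L⁻`, and every `c` carrying the uniform residual λ-formula `P(c)` on the `Δ < 0`,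
`a₂ = 0` family: `#R⁺_{S₀}(W[2]) = 2^(d + Σ_g + c)`. Under `P(c)` the curve `W` lies in its own family, so the count is
`2^(λ(X⁺_W) + Σ_W + c)` and RMC says exactly `λ(X⁺_W) + Σ_W = d + Σ_g`:
* `≥` is the one-sided item RTC≥ `ResidualThetaCountLowerAtTwo` (25435; ⟸ PUB-G ∧ GZK ∧ (R≥)ᵖ 26074 by the landed
  `residualThetaCountLowerAtTwo_of_residualLower`, p606001) — the research heart;
* `≤` is Kato ∧ the analytic theta transport, both route items: a Pollack pair of the newform `f` of `W` at `2` EXISTS in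
  the tree (`Theorems.exists_isPollackPair_two`: Sprung's pair at `2` is a Pollack pair when `a₂ = 0` and `L(E,1) ≠ 0`;
  the lead's memo RGE-RESTATEMENT-g8 §3 still listed this existence as missing), the newform and the period ratio `ϖ`
  come from the modularity item `ModularParametrizationSupply` (19266), K3 `SignedKatoDivisibilityUpToAtTwo` gives
  `λ(X⁺_W) = λ(g₁) ≤ λ(G)` for ITS OWN `G = g₁ h` with `ι G = 2^m ϖ ι L⁺_W` (the argument of the lead's
  `lambdaInvariant_le_lam_of_signedKato`, p593028, without the rescaling step), and
  Kan⁺ `ThetaLayerLambdaCongruenceAtTwo` read through the two landed layer laws (`stub_analyticLayerLawAtTwo`,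
  `stub_analyticLayerLawKAtTwo`, at the item's own cohomological `Ω` and Pollack pair of `g`) gives `λ(G) + Σ_W = d + Σ_g`.
So this file proves, all BY NAME over route decls:

* `residualThetaCountAtTwo_of_countLower` : `ModularParametrizationSupply → ResidualThetaCountLowerAtTwo →
  SignedKatoDivisibilityUpToAtTwo → ThetaLayerLambdaCongruenceAtTwo → ResidualThetaCountAtTwo` (24195 ⟸ 19266 ∧ 25435 ∧
  20308 ∧ 20688);
* `residualThetaCountAtTwo_of_residualLowerPure` : `ModularParametrizationSupply → PublishedInputsGreenbergControlAtTwo →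
  RankEqAnalyticRankLeOne → ResidualThetaCountLowerPureAtTwo → SignedKatoDivisibilityUpToAtTwo →
  ThetaLayerLambdaCongruenceAtTwo → ResidualThetaCountAtTwo` (24195 ⟸ 19266 ∧ 24143 ∧ 19921 ∧ 26074 ∧ 20308 ∧ 20688);
* `residualThetaCountAtTwo_of_residualLowerPure_of_pub` : the same with K3 replaced by its PUB twin
  `SignedKatoDivisibilityUpToAtTwoOfPub` (25631) and `KatoEulerSystemBoundContraAtTwoSupply` (25632), exactly as the
  route's deciding theorem consumes them;
* `residualThetaCountLowerAtTwo_of_count` : the converse 24195 ⟹ 25435 (`.ge`; the lead's cert `low_of_count`).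

Hence 24195 ≡ 25435 modulo the route's own {19266, 20308, 20688}: once (R≥)ᵖ, K3 and Kan⁺ close, 24195 closes by the
second theorem with the route's PUB binders. Conditional; closes nothing by itself.

References: [Kato2004] Thm. 17.4; [Kobayashi2003] Thm. 1.3; [GreenbergVatsal2000] Prop. 2.8 and (10); [PollackWeston2011MT]
§3–4; [Sprung2017] §1.1, Thm. 1.12, Cor. 4.4; [Pollack2003] Prop. 6.18; [Matsuno2008] Lemma 2.4.
-/

set_option autoImplicit false
-- D-0017: single-problem summit, so `Summit.BirchSwinnertonDyer.BirchSwinnertonDyer.…` repeats a namespace BY DESIGN.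
set_option linter.dupNamespace false

noncomputable section

open scoped Classical

namespace Summit.BirchSwinnertonDyer.BirchSwinnertonDyer.Theorems.ResidualThetaLayer

open Summit.BirchSwinnertonDyer.BirchSwinnertonDyer.Theses.ResidualThetaTransportAtTwo

/-- **RMC (24195) BY NAME from modularity (19266), the one-sided count RTC≥ (25435), K3 (20308) and Kan⁺ (20688).**
Under the premise `P(c)` the habitat curve `W` lies in its own family: `#R⁺_{S₀}(W[2]) = 2^(λ(X⁺_W) + Σ_W + c)`. RTC≥ at
the same data gives `d + Σ_g ≤ λ(X⁺_W) + Σ_W`. Conversely: the newform `f` of `W` and the period ratio `ϖ` (19266), a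
Pollack pair of `f` at `2` (`exists_isPollackPair_two`, `L(W,1) ≠ 0` at analytic rank `0`), K3's own `G = g₁ h` with
`ι G = 2^m ϖ ι L⁺_W` and `λ(X⁺_W) = λ(g₁) ≤ λ(G)` (structure theorem + additivity), and Kan⁺ with the two landed layer
laws at a common large even layer give `λ(G) + Σ_W = d + Σ_g`. So the two exponents agree.
[cite: Kato2004, Thm. 17.4] [cite: PollackWeston2011MT, §3–4] [cite: Sprung2017, §1.1 and Thm. 1.12] -/
theorem residualThetaCountAtTwo_of_countLower
    (hmod : ModularParametrizationSupply) (hLow : ResidualThetaCountLowerAtTwo)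
    (hKato : SignedKatoDivisibilityUpToAtTwo) (han : ThetaLayerLambdaCongruenceAtTwo) :
    ResidualThetaCountAtTwo := by
  intro W _ _ hcm hr hss ha hΔ M _ g ι Ω hodd hnew hcmg ha2 hΩ hcong κ γ hκ hγ hcv S₀ hS2 hSW hSM D _ hX hμ Lp Lm d hPK
    hd1 hd2 c hP
  -- the count of `W` under the premise: `W` lies in its own family
  have h1 := hP W hss ha hΔ hSW D hX hμ
  -- the lower half (RTC≥) at the same data
  have h2 := hLow W hcm hr hss ha hΔ M g ι Ω hodd hnew hcmg ha2 hΩ hcong κ γ hκ hγ hcv S₀ hS2 hSW hSM D hX hμ Lp Lm d hPK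
    hd1 hd2 c hP
  rw [h1] at h2 ⊢
  have h3 := (Nat.pow_le_pow_iff_right (by norm_num : 1 < 2)).mp h2
  have hS' : ∀ v ∈ S₀, Rat.HeightOneSpectrum.natGenerator v ≠ 2 := fun v hv ↦
    Summit.BirchSwinnertonDyer.Rank1Residual.X2.EulerFactorInvariants.natGenerator_ne_of_natCast_not_mem v (hS2 v hv)
  rw [Literature.NumberTheory.EllipticCurves.sum_dMultiplicity_two_eq_sum_matsunoLocalTermAtTwo W S₀ hS'] at h3 ⊢
  -- the upper half: modularity supplies the newform `f` of `W` and the period ratio `ϖ`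
  haveI : NeZero (W.conductorNorm ℤ) := ⟨(W.conductorNorm_pos_holds).ne'⟩
  obtain ⟨Dm⟩ := hmod W
  have hf : Literature.NumberTheory.EllipticCurves.ModularForms.IsNewformOf W Dm.f := Dm.isNewformOf
  obtain ⟨ϖ, hϖpos, hϖ, -⟩ := Dm.exists_rat_mul_realPeriodRat_eq_plusPeriod
  -- `L(W,1) ≠ 0` at analytic rank `0`, so a Pollack pair of `f` at `2` exists (Sprung's pair at `2`)
  have hL : W.entireLFunction 1 ≠ 0 :=
    (W.analyticRank_eq_zero_iff_holds
      (Summit.BirchSwinnertonDyer.BirchSwinnertonDyer.Theorems.PublishedInputsOfNewform.entireLFunctionRat_of_modularParametrization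
        hmod W)).mp hr
  obtain ⟨Lplus, Lminus, -, hPP⟩ :=
    Summit.BirchSwinnertonDyer.BirchSwinnertonDyer.Theorems.exists_isPollackPair_two hf hss.1 ha hL
  -- K3: `Char X⁺ = (g₁)`, `ι (g₁ h) = 2^m ϖ ι L⁺_W`; Kato's half `λ(X) = λ(g₁) ≤ λ(g₁ h)`
  obtain ⟨g₁, h, m, hchar, hgh⟩ := hKato W hcm hr hss ha κ γ hκ hγ hcv Dm.f hf ϖ hϖ Lplus Lminus hPP D
  have hkL : Summit.BirchSwinnertonDyer.Rank1Residual.Supersingular.kobayashiL (1 : ℤˣ) Lplus Lminus = Lminus := by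
    unfold Summit.BirchSwinnertonDyer.Rank1Residual.Supersingular.kobayashiL; rw [if_pos rfl]
  have hgh0 : g₁ * h ≠ 0 := by
    intro h0
    rw [h0, map_zero, hkL] at hgh
    refine mul_ne_zero ((map_ne_zero_iff _ PowerSeries.C_injective).mpr
      (mul_ne_zero (pow_ne_zero m two_ne_zero) (by exact_mod_cast hϖpos.ne'))) ?_ hgh.symm
    intro hL0
    exact hPP.2.1 (Literature.NumberTheory.EllipticCurves.iwasawaToPowerSeries_injective 2 (by rw [hL0, map_zero]))
  have hle : Literature.NumberTheory.EllipticCurves.lambdaInvariant 2 D.X ≤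
      Summit.BirchSwinnertonDyer.Rank1Residual.X1.MuLambda.lam (g₁ * h) := by
    rw [← Summit.BirchSwinnertonDyer.Rank1Residual.X1.ParitySqueeze.lam_generator_eq_lambdaInvariant D.X hX
      (left_ne_zero_of_mul hgh0) hchar]
    exact Summit.BirchSwinnertonDyer.Rank1Residual.X1.MuLambda.lam_le_lam_mul (left_ne_zero_of_mul hgh0)
      (right_ne_zero_of_mul hgh0)
  -- Kan⁺ at the item's cohomological `Ω` and the two landed layer laws at a common large even layer
  obtain ⟨n₁, hn₁⟩ := han W hcm hr hss ha hΔ M g ι Ω hodd hnew hcmg ha2 hΩ.isPlusPeriod hcong Dm.f hf S₀ hS2 hSW hSM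
  obtain ⟨n₂, hn₂⟩ := stub_analyticLayerLawKAtTwo M g ι Ω hnew Lp Lm d hPK hd1 hd2 S₀ hS2
  obtain ⟨n₃, hn₃⟩ := stub_analyticLayerLawAtTwo W hcm hr hss ha hΔ M g ι Ω hodd hnew hcmg ha2 hΩ.isPlusPeriod hcong κ γ
    hκ hγ hcv Dm.f hf ϖ hϖ Lplus Lminus hPP S₀ hS2 hSW hSM D (g₁ * h) m hgh
  have e1 := hn₁ (2 * max n₁ (max n₂ n₃)) (by omega) (even_two_mul _)
  have e2 := hn₂ (2 * max n₁ (max n₂ n₃)) (by omega) (even_two_mul _)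
  have e3 := hn₃ (2 * max n₁ (max n₂ n₃)) (by omega) (even_two_mul _)
  rw [e1, e2] at e3
  congr 1
  omega

/-- **RMC (24195) BY NAME from modularity (19266), PUB-G (24143), GZK (19921), the pure one-sided count (R≥)ᵖ (26074),
K3 (20308) and Kan⁺ (20688)**: the previous theorem composed with the bridge RTC≥ ⟸ PUB-G ∧ GZK ∧ (R≥)ᵖ (the landed
`residualThetaCountLowerAtTwo_of_residualLower`, p606001, re-derived inline to keep this module off route-dependent
imports: at analytic rank `0` `Sel_{2^∞}(W/ℚ)` is finite by GZK, the print road `SignedTransportAtTwo.rlf2_of_print4`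
counts `#R⁺_{S₀}(W[2]) = 2^(λ(X⁺_W) + Σ_W)`, so the premise pins `c = 0`).
[cite: GreenbergVatsal2000, Prop. 2.8 and (10)] [cite: GreenbergLNM1716, Props. 4.12–4.15] [cite: Kato2004, Thm. 17.4] -/
theorem residualThetaCountAtTwo_of_residualLowerPure
    (hmod : ModularParametrizationSupply) (hPubG : PublishedInputsGreenbergControlAtTwo)
    (hGZK : RankEqAnalyticRankLeOne) (hRge : ResidualThetaCountLowerPureAtTwo)
    (hKato : SignedKatoDivisibilityUpToAtTwo) (han : ThetaLayerLambdaCongruenceAtTwo) :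
    ResidualThetaCountAtTwo := by
  refine residualThetaCountAtTwo_of_countLower hmod ?_ hKato han
  -- RTC≥ ⟸ PUB-G ∧ GZK ∧ (R≥)ᵖ (the landed `residualThetaCountLowerAtTwo_of_residualLower`, p606001, re-derived here so
  -- that this module does not stack on a route-dependent one): the print count pins `c = 0`
  intro W _ _ hcm hr hss ha hΔ M _ g ι Ω hodd hnew hcmg ha2 hΩ hcong κ γ hκ hγ hcv S₀ hS2 hSW hSM D _ hX hμ Lp Lm d hPK
    hd1 hd2 c hP
  obtain ⟨hC, h412, hcork, -, hWL⟩ := hPubG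
  -- `Sel_{2^∞}(W/ℚ)` is finite at analytic rank `0` (GZK: rank `0` and `Ш` finite)
  have hSel : Finite (W.selmerGroupPInfty 2) := by
    have hr0 : W.mordellWeilRank = 0 := (hGZK W (by omega)).1.trans hr
    haveI : Finite W.toAffine.Point := W.mordellWeilRank_eq_zero_iff_finite.mp hr0
    haveI : Finite W.sha := (hGZK W (by omega)).2
    have hcard : Nat.card (W.selmerGroupPInfty 2) = Nat.card (AddCommGroup.primaryComponent W.sha 2) :=
      W.natCard_selmerGroupPInfty_eq_natCard_primaryComponent_sha 2
    exact Nat.finite_of_card_ne_zero (by rw [hcard]; exact Nat.card_pos.ne')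
  -- the count of `W`: from print (`c = 0`) and from the premise (`+ c`)
  have h1 := Summit.BirchSwinnertonDyer.BirchSwinnertonDyer.Theorems.SignedTransportAtTwo.rlf2_of_print4 hC h412 hcork hWL
    κ γ hκ hγ S₀ hS2 W hss ha hΔ hSW hSel D hX hμ
  have h1' := hP W hss ha hΔ hSW D hX hμ
  have hc : c = 0 := by
    have h := h1'.symm.trans h1
    have h' := Nat.pow_right_injective (le_refl 2) h
    omega
  subst hc
  simpa only [Nat.add_zero] using
    hRge W hcm hr hss ha hΔ M g ι Ω hodd hnew hcmg ha2 hΩ hcong κ γ hκ hγ hcv S₀ hS2 hSW hSM D hX hμ Lp Lm d hPK hd1 hd2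

/-- **RMC (24195) BY NAME in the currency of the route's deciding theorem**: K3 from its PUB twin
`SignedKatoDivisibilityUpToAtTwoOfPub` (25631) with `KatoEulerSystemBoundContraAtTwoSupply` (25632) and GZK, exactly as
`closes` does (`hKatoP hKES hGZK`). [cite: Kato2004, Thm. 12.5 and Thm. 17.4] -/
theorem residualThetaCountAtTwo_of_residualLowerPure_of_pub
    (hmod : ModularParametrizationSupply) (hPubG : PublishedInputsGreenbergControlAtTwo)
    (hGZK : RankEqAnalyticRankLeOne) (hRge : ResidualThetaCountLowerPureAtTwo)
    (hKES : KatoEulerSystemBoundContraAtTwoSupply) (hKatoP : SignedKatoDivisibilityUpToAtTwoOfPub)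
    (han : ThetaLayerLambdaCongruenceAtTwo) :
    ResidualThetaCountAtTwo :=
  residualThetaCountAtTwo_of_residualLowerPure hmod hPubG hGZK hRge (hKatoP hKES hGZK) han

/-- **The converse, 24195 ⟹ 25435** (the lead's certificate `low_of_count`, RgeItemCert.lean): the two-sided count gives
the one-sided one by `.ge`. With `residualThetaCountAtTwo_of_countLower` this makes RMC and RTC≥ EQUIVALENT modulo the
route's own modularity, K3 and Kan⁺. [cite: GreenbergVatsal2000, Prop. 2.8 and (10)] -/
theorem residualThetaCountLowerAtTwo_of_count (h : ResidualThetaCountAtTwo) : ResidualThetaCountLowerAtTwo := by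
  intro W _ _ hcm hr hss ha hΔ M _ g ι Ω hodd hnew hcmg ha2 hΩ hcong κ γ hκ hγ hcv S₀ hS2 hSW hSM D _ hX hμ Lp Lm d hPK
    hd1 hd2 c hP
  exact (h W hcm hr hss ha hΔ M g ι Ω hodd hnew hcmg ha2 hΩ hcong κ γ hκ hγ hcv S₀ hS2 hSW hSM D hX hμ Lp Lm d hPK hd1 hd2
    c hP).ge

/-! ## Appendix (rtt-w5 g0, same session): the PREMISE-FREE currency of (R≥)ᵖ 26074

The two theorems below restate the content of this file in the pure currency of the live crux (R≥)ᵖ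
`ResidualThetaCountLowerPureAtTwo` (26074: `2^(d + Σ_g) ≤ #R⁺_{S₀}(W[2])`, no uniform-family premise, no `c`): its `≤` twin
is a THEOREM modulo the route's own print and cruxes K3, Kan⁺ (Kato's divisibility read residually through the analytic
theta transport), and with (R≥)ᵖ the residual set is counted EXACTLY by the `S₀`-imprimitive analytic λ of the CM partner.
Binder block = 26074's VERBATIM (same `open … in` short form, behind `open Literature in` as in the route file); only the
final relation differs. -/

/-- **The pure UPPER residual theta count at `2` — the `≤` twin of (R≥)ᵖ 26074 — from modularity (19266), PUB-G (24143),
GZK (19921), K3 (20308) and Kan⁺ (20688):** on 26074's binder block, `#R⁺_{S₀}(W[2]) ≤ 2^(d + Σ_g)`. Print counts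
`#R⁺_{S₀}(W[2]) = 2^(λ(X⁺_W) + Σ_W)` (`SignedTransportAtTwo.rlf2_of_print4`, `Sel_{2^∞}(W/ℚ)` finite by GZK); the newform
`f` of `W`, the period ratio `ϖ` and a Pollack pair of `f` at `2` (`exists_isPollackPair_two`) feed K3, whose own `G = g₁ h`
has `λ(X⁺_W) = λ(g₁) ≤ λ(G)`; Kan⁺ with the two landed layer laws gives `λ(G) + Σ_W = d + Σ_g`. Kato's divisibility read
residually: the ONE residual object has AT MOST as many classes as the partner's imprimitive analytic λ predicts.
[cite: Kato2004, Thm. 17.4] [cite: GreenbergVatsal2000, Prop. 2.8 and (10)] [cite: PollackWeston2011MT, §3–4]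
[cite: Sprung2017, §1.1 and Thm. 1.12] -/
theorem residualThetaCountUpperPureAtTwo_of_pub
    (hmod : ModularParametrizationSupply) (hPubG : PublishedInputsGreenbergControlAtTwo)
    (hGZK : RankEqAnalyticRankLeOne) (hKato : SignedKatoDivisibilityUpToAtTwo) (han : ThetaLayerLambdaCongruenceAtTwo) :
    open Literature in open NumberTheory.EllipticCurves in open Kobayashi2003 GreenbergVatsal2000 ModularForms Rank1Residual GreenbergSelmer IsDedekindDomain NumberField AddSubgroup Field PowerSeries Rat.HeightOneSpectrum in ∀ (W : WeierstrassCurve ℚ) [W.IsElliptic] [W.IsGloballyMinimal], ¬ W.HasCM → W.analyticRank = 0 → GoodSS W 2 → W.frobeniusTrace 2 = 0 → W.Δ < 0 → ∀ (M : ℕ) [NeZero M] (g : CuspForm (CongruenceSubgroup.Gamma0 M) 2) (ι : coeffField g →+* PadicAlgCl 2) (Ω : ℂ), Odd M → IsNewform0 g → Literature.NumberTheory.Automorphic.IsCMForm (liftToGamma1 M 2 g) → cuspCoeff g 2 = 0 → IsCohomologicalPlusPeriod g ι Ω → (∀ ℓ : ℕ, ℓ.Prime → ¬ ℓ ∣ 2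 * M * W.conductorNorm ℤ → ‖embCoeff g ι ℓ - (W.frobeniusTrace ℓ : PadicAlgCl 2)‖ < 1) → ∀ (κ : ZpExtension ℚ 2) (γ : absoluteGaloisGroup ℚ), κ.IsCyclotomic → κ.IsTopGenerator γ → IsCyclotomicVariable 2 γ → ∀ (S₀ : Finset (HeightOneSpectrum (RingOfIntegers ℚ))), (∀ v ∈ S₀, ((2 : ℕ) : RingOfIntegers ℚ) ∉ v.asIdeal) → (∀ v : HeightOneSpectrum (RingOfIntegers ℚ), ¬ W.HasGoodReductionAt v → v ∈ S₀) → (∀ v : HeightOneSpectrum (RingOfIntegers ℚ), natGenerator v ∣ M → v ∈ S₀) → ∀ (D : SignedSelmerDualData W κ γ 1) [Module.Finite (IwasawaAlgebra 2) D.X], Module.IsTorsion (IwasawaAlgebra 2) D.X → D.mu = 0 → ∀ (Lp Lm : IwasawaAlgebraO (Set.range ι)) (d : ℕ), IsPollackPairK g ι Ω Lp Lm → (∀ k : ℕ, ‖coeff k (iwasawaOToPowerSeries (Set.range ι) Lm)‖ ≤ ‖coeff d (iwasawaOToPowerSeries (Set.range ι) Lm)‖) → (∀ k : ℕ, k < d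 → ‖coeff k (iwasawaOToPowerSeries (Set.range ι) Lm)‖ < ‖coeff d (iwasawaOToPowerSeries (Set.range ι) Lm)‖) → {x : subgroupH1 κ.kerSubgroup ↥(torsionBy ↥(W.geomPrimaryTorsion 2) (2 : ℤ)) | x ∈ unramifiedOutside κ.kerSubgroup ↥(torsionBy ↥(W.geomPrimaryTorsion 2) (2 : ℤ)) 2 (↑S₀ : Set (HeightOneSpectrum (RingOfIntegers ℚ))) ∧ (∀ (w : InfinitePlace ℚ) (σ : absoluteGaloisGroup ℚ), conjH1 κ.kerSubgroup ↥(torsionBy ↥(W.geomPrimaryTorsion 2) (2 : ℤ)) σ x ∈ infKer κ.kerSubgroup ↥(torsionBy ↥(W.geomPrimaryTorsion 2) (2 : ℤ)) w) ∧ (∀ (v : HeightOneSpectrum (RingOfIntegers ℚ)), ((2 : ℕ) : RingOfIntegers ℚ) ∈ v.asIdeal → ∀ σ : absoluteGaloisGroup ℚ, W.conjH1 2 κ.kerSubgroup σ (pushH1 κ.kerSubgroup (torsionBy ↥(W.geomPrimaryTorsion 2) (2 : ℤ)).subtype (fun _ _ ↦ rfl) x) ∈ localKummerOverOfEmb W 2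 κ.kerSubgroup (closureEmb (K := ℚ) (v.adicCompletion ℚ)) (⨆ n : ℕ, signedLocalPoints κ (v.adicCompletion ℚ) W 1 n))}.ncard ≤ 2 ^ (d + (∑ v ∈ S₀, 2 ^ padicValNat 2 ((natGenerator v ^ 2 - 1) / 8) * (if natGenerator v ∣ M then (if ‖embCoeff g ι (natGenerator v) - 1‖ < 1 then 1 else 0) else (if ‖embCoeff g ι (natGenerator v)‖ < 1 then 2 else 0)))) := by
  intro W _ _ hcm hr hss ha hΔ M _ g ι Ω hodd hnew hcmg ha2 hΩ hcong κ γ hκ hγ hcv S₀ hS2 hSW hSM D _ hX hμ Lp Lm d hPK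
    hd1 hd2
  obtain ⟨hC, h412, hcork, -, hWL⟩ := hPubG
  -- `Sel_{2^∞}(W/ℚ)` is finite at analytic rank `0` (GZK: rank `0` and `Ш` finite)
  have hSel : Finite (W.selmerGroupPInfty 2) := by
    have hr0 : W.mordellWeilRank = 0 := (hGZK W (by omega)).1.trans hr
    haveI : Finite W.toAffine.Point := W.mordellWeilRank_eq_zero_iff_finite.mp hr0
    haveI : Finite W.sha := (hGZK W (by omega)).2
    have hcard : Nat.card (W.selmerGroupPInfty 2) = Nat.card (AddCommGroup.primaryComponent W.sha 2) :=
      W.natCard_selmerGroupPInfty_eq_natCard_primaryComponent_sha 2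
    exact Nat.finite_of_card_ne_zero (by rw [hcard]; exact Nat.card_pos.ne')
  -- the print count of `W`
  have h1 := Summit.BirchSwinnertonDyer.BirchSwinnertonDyer.Theorems.SignedTransportAtTwo.rlf2_of_print4 hC h412 hcork hWL
    κ γ hκ hγ S₀ hS2 W hss ha hΔ hSW hSel D hX hμ
  rw [h1]
  refine Nat.pow_le_pow_right (by norm_num) ?_
  have hS' : ∀ v ∈ S₀, Rat.HeightOneSpectrum.natGenerator v ≠ 2 := fun v hv ↦
    Summit.BirchSwinnertonDyer.Rank1Residual.X2.EulerFactorInvariants.natGenerator_ne_of_natCast_not_mem v (hS2 v hv)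
  rw [Literature.NumberTheory.EllipticCurves.sum_dMultiplicity_two_eq_sum_matsunoLocalTermAtTwo W S₀ hS']
  -- modularity: the newform `f` of `W`, the period ratio `ϖ`, `L(W,1) ≠ 0`, a Pollack pair of `f` at `2`
  haveI : NeZero (W.conductorNorm ℤ) := ⟨(W.conductorNorm_pos_holds).ne'⟩
  obtain ⟨Dm⟩ := hmod W
  have hf : Literature.NumberTheory.EllipticCurves.ModularForms.IsNewformOf W Dm.f := Dm.isNewformOf
  obtain ⟨ϖ, hϖpos, hϖ, -⟩ := Dm.exists_rat_mul_realPeriodRat_eq_plusPeriod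
  have hL : W.entireLFunction 1 ≠ 0 :=
    (W.analyticRank_eq_zero_iff_holds
      (Summit.BirchSwinnertonDyer.BirchSwinnertonDyer.Theorems.PublishedInputsOfNewform.entireLFunctionRat_of_modularParametrization
        hmod W)).mp hr
  obtain ⟨Lplus, Lminus, -, hPP⟩ :=
    Summit.BirchSwinnertonDyer.BirchSwinnertonDyer.Theorems.exists_isPollackPair_two hf hss.1 ha hL
  -- K3 and Kato's half `λ(X) = λ(g₁) ≤ λ(g₁ h)`
  obtain ⟨g₁, h, m, hchar, hgh⟩ := hKato W hcm hr hss ha κ γ hκ hγ hcv Dm.f hf ϖ hϖ Lplus Lminus hPP D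
  have hkL : Summit.BirchSwinnertonDyer.Rank1Residual.Supersingular.kobayashiL (1 : ℤˣ) Lplus Lminus = Lminus := by
    unfold Summit.BirchSwinnertonDyer.Rank1Residual.Supersingular.kobayashiL; rw [if_pos rfl]
  have hgh0 : g₁ * h ≠ 0 := by
    intro h0
    rw [h0, map_zero, hkL] at hgh
    refine mul_ne_zero ((map_ne_zero_iff _ PowerSeries.C_injective).mpr
      (mul_ne_zero (pow_ne_zero m two_ne_zero) (by exact_mod_cast hϖpos.ne'))) ?_ hgh.symm
    intro hL0
    exact hPP.2.1 (Literature.NumberTheory.EllipticCurves.iwasawaToPowerSeries_injective 2 (by rw [hL0, map_zero]))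
  have hle : Literature.NumberTheory.EllipticCurves.lambdaInvariant 2 D.X ≤
      Summit.BirchSwinnertonDyer.Rank1Residual.X1.MuLambda.lam (g₁ * h) := by
    rw [← Summit.BirchSwinnertonDyer.Rank1Residual.X1.ParitySqueeze.lam_generator_eq_lambdaInvariant D.X hX
      (left_ne_zero_of_mul hgh0) hchar]
    exact Summit.BirchSwinnertonDyer.Rank1Residual.X1.MuLambda.lam_le_lam_mul (left_ne_zero_of_mul hgh0)
      (right_ne_zero_of_mul hgh0)
  -- Kan⁺ at the cohomological `Ω` and the two landed layer laws at a common large even layer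
  obtain ⟨n₁, hn₁⟩ := han W hcm hr hss ha hΔ M g ι Ω hodd hnew hcmg ha2 hΩ.isPlusPeriod hcong Dm.f hf S₀ hS2 hSW hSM
  obtain ⟨n₂, hn₂⟩ := stub_analyticLayerLawKAtTwo M g ι Ω hnew Lp Lm d hPK hd1 hd2 S₀ hS2
  obtain ⟨n₃, hn₃⟩ := stub_analyticLayerLawAtTwo W hcm hr hss ha hΔ M g ι Ω hodd hnew hcmg ha2 hΩ.isPlusPeriod hcong κ γ
    hκ hγ hcv Dm.f hf ϖ hϖ Lplus Lminus hPP S₀ hS2 hSW hSM D (g₁ * h) m hgh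
  have e1 := hn₁ (2 * max n₁ (max n₂ n₃)) (by omega) (even_two_mul _)
  have e2 := hn₂ (2 * max n₁ (max n₂ n₃)) (by omega) (even_two_mul _)
  have e3 := hn₃ (2 * max n₁ (max n₂ n₃)) (by omega) (even_two_mul _)
  rw [e1, e2] at e3
  omega

/-- **The pure residual theta count at `2` as an EQUALITY, from (R≥)ᵖ (26074) and the route's print, K3 and Kan⁺:**
`#R⁺_{S₀}(W[2]) = 2^(d + Σ_g)` on 26074's binder block — the premise-free form of RMC 24195 (what 24195 says once the
uniform-family premise `P(c)` and the `+ c` are deleted, as the pen did for 25435 ↦ 26074). `≥` is (R≥)ᵖ BY NAME, `≤` the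
previous theorem. [cite: GreenbergVatsal2000, Prop. 2.8 and (10)] [cite: Kato2004, Thm. 17.4] -/
theorem residualThetaCountPureAtTwo_of_residualLowerPure
    (hmod : ModularParametrizationSupply) (hPubG : PublishedInputsGreenbergControlAtTwo)
    (hGZK : RankEqAnalyticRankLeOne) (hRge : ResidualThetaCountLowerPureAtTwo)
    (hKato : SignedKatoDivisibilityUpToAtTwo) (han : ThetaLayerLambdaCongruenceAtTwo) :
    open Literature in open NumberTheory.EllipticCurves in open Kobayashi2003 GreenbergVatsal2000 ModularForms Rank1Residual GreenbergSelmer IsDedekindDomain NumberField AddSubgroup Field PowerSeries Rat.HeightOneSpectrum in ∀ (W : WeierstrassCurve ℚ) [W.IsElliptic] [W.IsGloballyMinimal], ¬ W.HasCM → W.analyticRank = 0 → GoodSS W 2 → W.frobeniusTrace 2 = 0 → W.Δ < 0 → ∀ (M : ℕ) [NeZero M] (g : CuspForm (CongruenceSubgroup.Gamma0 M) 2) (ι : coeffField g →+* PadicAlgCl 2) (Ω : ℂ), Odd M → IsNewform0 g → Literature.NumberTheory.Automorphic.IsCMForm (liftToGamma1 M 2 g) → cuspCoeff g 2 = 0 →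 IsCohomologicalPlusPeriod g ι Ω → (∀ ℓ : ℕ, ℓ.Prime → ¬ ℓ ∣ 2 * M * W.conductorNorm ℤ → ‖embCoeff g ι ℓ - (W.frobeniusTrace ℓ : PadicAlgCl 2)‖ < 1) → ∀ (κ : ZpExtension ℚ 2) (γ : absoluteGaloisGroup ℚ), κ.IsCyclotomic → κ.IsTopGenerator γ → IsCyclotomicVariable 2 γ → ∀ (S₀ : Finset (HeightOneSpectrum (RingOfIntegers ℚ))), (∀ v ∈ S₀, ((2 : ℕ) : RingOfIntegers ℚ) ∉ v.asIdeal) → (∀ v : HeightOneSpectrum (RingOfIntegers ℚ), ¬ W.HasGoodReductionAt v → v ∈ S₀) → (∀ v : HeightOneSpectrum (RingOfIntegers ℚ), natGenerator v ∣ M → v ∈ S₀) → ∀ (D : SignedSelmerDualData W κ γ 1) [Module.Finite (IwasawaAlgebra 2) D.X], Module.IsTorsion (IwasawaAlgebra 2) D.X → D.mu = 0 → ∀ (Lp Lm : IwasawaAlgebraO (Set.range ι)) (d : ℕ), IsPollackPairK g ι Ω Lp Lm → (∀ k : ℕ, ‖coeff k (iwasawaOToPowerSeries (Set.range ι) Lm)‖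 ≤ ‖coeff d (iwasawaOToPowerSeries (Set.range ι) Lm)‖) → (∀ k : ℕ, k < d → ‖coeff k (iwasawaOToPowerSeries (Set.range ι) Lm)‖ < ‖coeff d (iwasawaOToPowerSeries (Set.range ι) Lm)‖) → {x : subgroupH1 κ.kerSubgroup ↥(torsionBy ↥(W.geomPrimaryTorsion 2) (2 : ℤ)) | x ∈ unramifiedOutside κ.kerSubgroup ↥(torsionBy ↥(W.geomPrimaryTorsion 2) (2 : ℤ)) 2 (↑S₀ : Set (HeightOneSpectrum (RingOfIntegers ℚ))) ∧ (∀ (w : InfinitePlace ℚ) (σ : absoluteGaloisGroup ℚ), conjH1 κ.kerSubgroup ↥(torsionBy ↥(W.geomPrimaryTorsion 2) (2 : ℤ)) σ x ∈ infKer κ.kerSubgroup ↥(torsionBy ↥(W.geomPrimaryTorsion 2) (2 : ℤ)) w) ∧ (∀ (v : HeightOneSpectrum (RingOfIntegers ℚ)), ((2 : ℕ) : RingOfIntegers ℚ) ∈ v.asIdeal → ∀ σ : absoluteGaloisGroup ℚ, W.conjH1 2 κ.kerSubgroup σ (pushH1 κ.kerSubgroup (torsionBy ↥(W.geomPrimaryTorsion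 2) (2 : ℤ)).subtype (fun _ _ ↦ rfl) x) ∈ localKummerOverOfEmb W 2 κ.kerSubgroup (closureEmb (K := ℚ) (v.adicCompletion ℚ)) (⨆ n : ℕ, signedLocalPoints κ (v.adicCompletion ℚ) W 1 n))}.ncard = 2 ^ (d + (∑ v ∈ S₀, 2 ^ padicValNat 2 ((natGenerator v ^ 2 - 1) / 8) * (if natGenerator v ∣ M then (if ‖embCoeff g ι (natGenerator v) - 1‖ < 1 then 1 else 0) else (if ‖embCoeff g ι (natGenerator v)‖ < 1 then 2 else 0)))) := by
  intro W _ _ hcm hr hss ha hΔ M _ g ι Ω hodd hnew hcmg ha2 hΩ hcong κ γ hκ hγ hcv S₀ hS2 hSW hSM D _ hX hμ Lp Lm d hPK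
    hd1 hd2
  exact le_antisymm
    (residualThetaCountUpperPureAtTwo_of_pub hmod hPubG hGZK hKato han W hcm hr hss ha hΔ M g ι Ω hodd hnew hcmg ha2 hΩ
      hcong κ γ hκ hγ hcv S₀ hS2 hSW hSM D hX hμ Lp Lm d hPK hd1 hd2)
    (hRge W hcm hr hss ha hΔ M g ι Ω hodd hnew hcmg ha2 hΩ hcong κ γ hκ hγ hcv S₀ hS2 hSW hSM D hX hμ Lp Lm d hPK hd1 hd2)

end Summit.BirchSwinnertonDyer.BirchSwinnertonDyer.Theorems.ResidualThetaLayer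

end
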